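import Literature.MathematicalPhysics.QuantumFieldTheory.Balaban1983to89.B15Prop1SliceSecondDerivative
import Literature.MathematicalPhysics.QuantumFieldTheory.Balaban1983to89.B16Ineq17NearFlatWilsonLetters
import Literature.MathematicalPhysics.QuantumFieldTheory.Balaban1983to89.B15Prop1ValueOfAnyMinimiser

/-!
# `Balaban1983to89.B15Prop1SliceHessianOfChartFamily` — [Balaban1989LargeFieldII] = «[LF-II]», p. 357 («we write U₀ = exp(iA₀) and expand …»), (1.7)–(1.9)
# p. 358, (1.12) p. 359; [Balaban1989LargeFieldI] = «[IV]», (1.77) and Prop. 1 p. 194; [Balaban1985Variational] = «[15]», (81) p. 290, Prop. 9 (190) p. 309: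
# ★★★ THE JUNCTION (t7) OF THE N12∕s1 LANE — THE SLICE HESSIAN PAIRING `⟪X, D(∇g)(0)X⟫` OF PRINT'S FUNCTION `g = A(U_{k,Z}(exp(i·ιA B′)·Ṽ_k))` IS THE
# VALUE HESSIAN ALONG A C² FAMILY OF MINIMISERS IN THE EXPONENTIAL CHART AT `U₀`, SO THE NEAR-FLAT ONE-SIDED SKELETON GIVES THE LETTER `h17`

Honest framing: statement-level skeleton of published theorems with citation tags; proofs where landed; nothing here is a claim about the
Yang–Mills mass gap.  Cell `pub-ymgap`, HUMAN RULING D-0062 ∕ D-0149, seat `pub-ymgap-dag-n12-c` (g17; N12 = [B15], strategy s1, lane owner); count-neutral helper of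
K1⁷; N12 NOT discharged; finite 𝕋⁴ at fixed ε; nothing continuum ∕ OS ∕ mass-gap ∕ Clay.

WHY.  The (L2) letter of every N12∕s1 endpoint of record (`B15Prop1OneSidedIneq17Edition` :395, `B15Prop1JointHolomorphyFromMinimiserFamilyOneSided` :113,
`B15Prop1ClosedGuardUniformRadius` §3) is `h17`: `γ₀·circ(X) − Cerr‖X‖² ≤ ⟪X, (fderiv ℝ (rGrad S T (sliceFn S T f Ṽ_k)) 0) X⟫` for `f = fun177std bg M₁ Z k` — the diagonal
of the Hessian of print's function of `B′` ([LF-II] (1.12)) in the gauge-fixed coordinates `X ∈ GaugeSlice S T E3`.  The w-wave delivered its two halves in OTHER currencies: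
dag-n12-w4's near-flat one-sided skeleton `B16Ineq17NearFlatWilsonLetters.hessian_wilsonAction4_criticalExpChartFamily_ge_flatMin_sub` (p599997) bounds from below the VALUE
Hessian `D²(g ↦ A(U₀·exp(X_f g)))(g₀)[h,h]` along a C² family `X_f` in the exponential chart `Node00.expChart U₀` of a constrained-critical `U₀` (letters (δ₁)(β) inhabited,
(μ)(δ₂)(ρ)(K), `hm` displayed), and dag-n12-w2's (S1) `B15Prop1SliceSecondDerivative.inner_fderiv_rGrad` identifies `⟪X, D(∇g)(0)Y⟫` with `D²g(0)(Y)(X)`.  THIS MODULE is the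
ONE-THEOREM junction the lane owes (HOME HANDOFF g16∕g17, trigger t7): (j2) along the slice, print's (1.77) IS the action of ANY minimiser
(`B15Prop1ValueOfAnyMinimiser`), so a family `Y ↦ U₀·exp(X_f Y)` of (2.12) minimisers for the data `exp(i·ιA Y)·Ṽ_k` near `Y = 0` (the letter (K′) — the real,
twice-differentiable shadow of the intrinsic analytic letter (J0′); produced by the w1 lineage's implicit-function family) makes `sliceFn S T f Ṽ_k` AGREE near `0` with
`Y ↦ A(expChart U₀ (X_f Y))`; (j1)+(j3) second derivatives of eventually-equal functions agree, the second-order chain rule (dag-n12-w3's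
`B11Eq177CriticalFamilyDerivative.hasFDerivAt_fderiv_comp`) supplies `D²` of the composite, and (S1) turns it into the pairing.  Then p599997's conclusion IS `h17`'s right-hand
side, and with the letters (K) `p(X_f′X) ≤ K_c‖X‖` and `γ₀·circ(X) ≤ m` (dag-n12-w4's Federbush fibre `hm`, `…N12NearFlatFederbushFibre[Chart]`) the inequality takes the
`h17` SHAPE with `Cerr = (32(d−1)δ + μ + 16(d−1)ρδ₂(2+ρδ₂))·K_c²`.

CONTENTS (theorems only; no `def`, no `instance`, no `sorry`).
* §1 ★ `eventually_sliceFn_fun177std_bgOfRecord_eq_wilsonAction4` ∕ ★ `eventually_sliceFn_fun177std_bgMSCoPOfRecord_eq_wilsonAction4` — (j2): a family of minimisers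
  along the slice near `0` ⇒ print's function along the slice IS the action of the family, eventually (any class; NODE 00's class of record).
* §2 ★★ `hasFDerivAt_fderiv_sliceFn_of_chartFamily` (the slice function has the composite's second derivative at `0`), ★★★
  `inner_fderiv_rGrad_sliceFn_eq_hessian_chartFamily` (`⟪X, D(∇ sliceFn)(0) Y⟫ = D²(A∘expChart U₀∘X_f)(0) Y X`).
* §3 ★★★ `le_inner_fderiv_rGrad_sliceFn_of_hessian_chartFamily_ge` (ANY lower bound for the value Hessian along the family at `h = X` is a lower bound for the pairing),
  ★★★ `h17Shape_of_hessian_chartFamily_ge` (the `h17` SHAPE `γ₀·circ − C·K_c²·‖X‖² ≤ ⟪…⟫` from a bound `m − C·p(X_f′X)² ≤ …`, `γ₀·circ ≤ m`, `p(X_f′X) ≤ K_c‖X‖`, `0 ≤ C`).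
* §4 ★★★ `h17Shape_sliceFn_of_nearFlatCriticalExpChartFamily` — p599997 VERBATIM at the parameter space `G := GaugeSlice S T E3`, base `g₀ := 0`, direction `h := X`, composed
  with §2–§3: the `h17` shape for `sliceFn S T f Ṽ_k` from the near-flat skeleton's letters + (K′) `hval` + (K) + `γ₀·circ ≤ m`.
* §5 (v1.1) ★★★ `h17Shape_of_hessian_chartFamily_ge_sub`, ★★★ `h17Shape_sliceFn_of_nearFlatCriticalExpChartFamily_sub` — the TWIST editions: the Federbush letter with a quadratic defect
  `γ₀·circ − τ·‖X‖² ≤ m` (what the Ad-twisted producers deliver, dag-n12-w4's located (R2)∕(T)), `τ` joining `Cerr`.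
HONEST SCOPE: finite-dimensional calculus (eventual equality ⇒ equal second derivatives; second-order chain rule; Riesz pairing) and one line of arithmetic; the letters of the
skeleton ((μ)(δ₂)(ρ)(K), the multiplier form `hlam`, the affine datum `haff`, `hm`) and the family letter (K′) stay DISPLAYED; nothing of Bałaban's is asserted.
-/

noncomputable section

open Set Metric Filter
open scoped InnerProductSpace Topology BigOperators

namespace Literature.MathematicalPhysics.QuantumFieldTheory.Balaban1983to89.B15Prop1SliceHessianOfChartFamily

open B15Prop1SliceCoordinates (GaugeSlice ιA)
open B15Prop1SliceTaylorCalculus (rGrad rieszR inner_rGrad inner_rieszR sliceFn sliceFn_apply)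
open B15Prop1SliceSecondDerivative (inner_fderiv_rGrad hasFDerivAt_rGrad_of_fderiv)
open B15Prop1ChartCalculusSU2 (E3)
open B15Prop1ChartSU2 (su2Chart)
open T4CubeChartGnomonic (SU2)
open T4Continuum B15DeterminingSets GaugeField
open T4AdjointCovarianceUnitary (lieSU)
open Node00
open scoped Matrix.Norms.L2Operator
open B11Eq177CriticalFamilyDerivative (contDiff_wilsonAction4_expChart hasFDerivAt_fderiv_wilsonAction4_expChart hasFDerivAt_fderiv_comp)
open B16Ineq17NearFlatWilsonLetters (hessian_wilsonAction4_criticalExpChartFamily_ge_flatMin_sub)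
open B16Sect1Backgrounds (expMul)
open B15Eq177ValueInvariance B15Sect1Instances B14.Eq213DetSet B14.Eq216Concrete
open B15Prop1ValueOfAnyMinimiser (fun177std_bgOfRecord_eq_wilsonAction4_of_isMinimizer fun177std_bgMSCoPOfRecord_eq_wilsonAction4_of_isMinimizer)
open Literature.MathematicalPhysics.QuantumFieldTheory.BalabanImbrieJaffe1984to88.BIJ85Eq453GaugeField (qsstarGIter0)

variable {P : Params} {k : ℕ} [DecidableEq (PBond P k)] (S : Set (Site P k)) (T : Finset (PBond P k))

/-! ## §1  (j2) Along the slice, print's (1.77) is the action of any family of minimisers -/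

section Value

/-- ★ **(j2) AT NODE 00's TOTALISED SOLUTION MAP `bgOfRecord av reg` (any averaging, any class)**: if near `Y = 0` the configuration `U Y` is a MINIMAL CONFIGURATION of the
(2.12) problem for the datum `M˙(Q_k^{s*}(exp(i·ιA Y)·Ṽ_k))` on `𝐁_k(Z)`, then print's function along the slice, `sliceFn S T (fun177std (bgOfRecord av reg) M₁ Z k) Ṽ_k`,
AGREES near `0` with `Y ↦ A(U Y)` — (1.77) is the VALUE of the constrained problem (`B15Prop1ValueOfAnyMinimiser`), read pointwise along the family.
[cite: Balaban1989LargeFieldI, (1.74) p.192, (1.77) p.194; Balaban1989LargeFieldII, p.359; Balaban1988Convergent, (2.12) p.256; Balaban1985Variational, Prop. 9 (190) p.309] -/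
theorem eventually_sliceFn_fun177std_bgOfRecord_eq_wilsonAction4 (av : ∀ j, Averaging P j SU2) (reg : Set (GaugeField P 0 SU2))
    (M₁ : ℕ) (Z : Set (Site P 0)) (V : GaugeField P k SU2) {U : GaugeSlice S T E3 → GaugeField P 0 SU2}
    (hmin : ∀ᶠ Y in 𝓝 (0 : GaugeSlice S T E3),
      IsMinimizer av reg (Bj M₁ Z k) (avgFamily av (qsstarGIter0 k (expMul su2Chart (ιA S T Y) V))) (U Y)) :
    ∀ᶠ Y in 𝓝 (0 : GaugeSlice S T E3), sliceFn S T (fun177std (bgOfRecord av reg) M₁ Z k) V Y = wilsonAction4 (U Y) :=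
  hmin.mono fun Y hY => by
    rw [sliceFn_apply]
    exact fun177std_bgOfRecord_eq_wilsonAction4_of_isMinimizer av reg M₁ Z k hY

/-- ★ **(j2) AT NODE 00's CLASS OF RECORD** (the background of the N12∕s1 endpoints, `Node00.bgMSCoPOfRecord F 2 ν Kt k′ Ω` with `Ω = maxDomT ν.M₁ Z` at the record): a family
`U Y` of minimisers of the data along the slice near `0` ⇒ `sliceFn S T (fun177std (bgMSCoPOfRecord F 2 ν Kt k′ Ω) M₁ Z k) Ṽ_k Y = A(U Y)` near `0`.
[cite: Balaban1989LargeFieldI, (1.74) p.192, (1.77) p.194; Balaban1989LargeFieldII, p.359; Balaban1988Convergent, (2.12) p.256; Balaban1985Variational, (2) p.278, Prop. 9 (190) p.309] -/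
theorem eventually_sliceFn_fun177std_bgMSCoPOfRecord_eq_wilsonAction4 {F : T4Family} (ν : Stage7Numerics) (Kt k' : ℕ) (Ω : ℕ → Set (Site (F.P Kt) 0))
    (M₁ : ℕ) (Z : Set (Site (F.P Kt) 0)) {k : ℕ} [DecidableEq (PBond (F.P Kt) k)] (S : Set (Site (F.P Kt) k)) (T : Finset (PBond (F.P Kt) k))
    (V : GaugeField (F.P Kt) k SU2) {U : GaugeSlice S T E3 → GaugeField (F.P Kt) 0 SU2}
    (hmin : ∀ᶠ Y in 𝓝 (0 : GaugeSlice S T E3),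
      IsMinimizer (avOfRecord F 2 Kt) (regMSCoPOfRecord F 2 ν Kt k' Ω) (Bj M₁ Z k)
        (avgFamily (avOfRecord F 2 Kt) (qsstarGIter0 k (expMul su2Chart (ιA S T Y) V))) (U Y)) :
    ∀ᶠ Y in 𝓝 (0 : GaugeSlice S T E3), sliceFn S T (fun177std (bgMSCoPOfRecord F 2 ν Kt k' Ω) M₁ Z k) V Y = wilsonAction4 (U Y) :=
  hmin.mono fun Y hY => by
    rw [sliceFn_apply]
    exact fun177std_bgMSCoPOfRecord_eq_wilsonAction4_of_isMinimizer (N := 2) ν Kt k' Ω M₁ Z k hY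

end Value

/-! ## §2  (j1)+(j3) The slice Hessian pairing is the value Hessian along the chart family -/

section Pairing

/-- ★★ **THE SLICE FUNCTION HAS THE COMPOSITE'S SECOND DERIVATIVE AT `0`.**  Let `X_f : GaugeSlice S T E3 → (bonds → 𝔰𝔲(2))` be twice differentiable at `0` in the sense of
dag-n12-w3's critical families (`HasFDerivAt X_f X_f′ 0`, `HasFDerivAt (D X_f) X₂ 0`, differentiable near `0`), and suppose `sliceFn S T f Ṽ_k` AGREES near `0` with the composite
`Y ↦ A(expChart U₀ (X_f Y))` (hypothesis `hval`, §1).  Then `Y ↦ D(sliceFn S T f Ṽ_k)(Y)` has at `0` the derivative of `Y ↦ D(A∘expChart U₀∘X_f)(Y)` given by the second-order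
chain rule (the action along the chart is `C^∞`, `contDiff_wilsonAction4_expChart`).
[cite: Balaban1985Variational, (81) p.290, (177) p.306; Balaban1989LargeFieldII, (1.12) p.359] -/
theorem hasFDerivAt_fderiv_sliceFn_of_chartFamily (f : GaugeField P k SU2 → ℝ) (V : GaugeField P k SU2) (U₀ : GaugeField P 0 SU2)
    {Xf : GaugeSlice S T E3 → PBond P 0 → lieSU (Fin 2)} {X' : GaugeSlice S T E3 →L[ℝ] PBond P 0 → lieSU (Fin 2)} (hX : HasFDerivAt Xf X' 0)
    {X₂ : GaugeSlice S T E3 →L[ℝ] GaugeSlice S T E3 →L[ℝ] PBond P 0 → lieSU (Fin 2)} (hX₂ : HasFDerivAt (fun Y => fderiv ℝ Xf Y) X₂ 0)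
    (hXd : ∀ᶠ Y in 𝓝 (0 : GaugeSlice S T E3), DifferentiableAt ℝ Xf Y)
    (hval : ∀ᶠ Y in 𝓝 (0 : GaugeSlice S T E3), sliceFn S T f V Y = wilsonAction4 (expChart U₀ (Xf Y))) :
    HasFDerivAt (fun Y => fderiv ℝ (sliceFn S T f V) Y)
      (fderiv ℝ (fun Y => fderiv ℝ (fun Y : GaugeSlice S T E3 => wilsonAction4 (expChart U₀ (Xf Y))) Y) 0) 0 := by
  haveI : ContinuousSMul ℝ (GaugeSlice S T E3) := IsBoundedSMul.continuousSMul
  -- the composite has a second derivative at `0` (second-order chain rule, `C^∞` action along the chart)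
  have hG : HasFDerivAt (fun Y => fderiv ℝ (fun Y : GaugeSlice S T E3 => wilsonAction4 (expChart U₀ (Xf Y))) Y)
      ((ContinuousLinearMap.compL ℝ (GaugeSlice S T E3) (PBond P 0 → lieSU (Fin 2)) ℝ
          (fderiv ℝ (fun X : PBond P 0 → lieSU (Fin 2) => wilsonAction4 (expChart U₀ X)) (Xf 0))).comp X₂ +
        ((ContinuousLinearMap.compL ℝ (GaugeSlice S T E3) (PBond P 0 → lieSU (Fin 2)) ℝ).flip X').comp
          ((fderiv ℝ (fun X => fderiv ℝ (fun X : PBond P 0 → lieSU (Fin 2) => wilsonAction4 (expChart U₀ X)) X) (Xf 0)).comp X')) 0 :=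
    hasFDerivAt_fderiv_comp (f := fun X : PBond P 0 → lieSU (Fin 2) => wilsonAction4 (expChart U₀ X)) (γ := Xf) rfl hX hX₂
      (hasFDerivAt_fderiv_wilsonAction4_expChart U₀ (Xf 0)) hXd
      (Filter.Eventually.of_forall fun X =>
        ((contDiff_wilsonAction4_expChart U₀).differentiable (by simp)).differentiableAt)
  -- the slice function agrees with the composite near `0`, hence so do the first derivatives near `0`
  have hval' : sliceFn S T f V =ᶠ[𝓝 (0 : GaugeSlice S T E3)] fun Y : GaugeSlice S T E3 => wilsonAction4 (expChart U₀ (Xf Y)) := hval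
  have hev : (fun Y => fderiv ℝ (sliceFn S T f V) Y) =ᶠ[𝓝 (0 : GaugeSlice S T E3)]
      fun Y => fderiv ℝ (fun Y : GaugeSlice S T E3 => wilsonAction4 (expChart U₀ (Xf Y))) Y :=
    hval'.fderiv
  rw [hG.fderiv]
  exact hG.congr_of_eventuallyEq hev

/-- ★★★ **THE SLICE HESSIAN PAIRING IS THE VALUE HESSIAN ALONG THE CHART FAMILY**: under the hypotheses of `hasFDerivAt_fderiv_sliceFn_of_chartFamily`,
`⟪X, D(∇ sliceFn S T f Ṽ_k)(0) Y⟫ = D²(Y ↦ A(expChart U₀ (X_f Y)))(0) Y X` — the pairing in which the N12∕s1 endpoints type [LF-II] (1.7) equals the value Hessian in which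
dag-n12-w4's near-flat skeleton concludes (by (S1) `inner_fderiv_rGrad`).
[cite: Balaban1989LargeFieldII, (1.7) p.358, (1.12) p.359; Balaban1985Variational, (81) p.290] -/
theorem inner_fderiv_rGrad_sliceFn_eq_hessian_chartFamily (f : GaugeField P k SU2 → ℝ) (V : GaugeField P k SU2) (U₀ : GaugeField P 0 SU2)
    {Xf : GaugeSlice S T E3 → PBond P 0 → lieSU (Fin 2)} {X' : GaugeSlice S T E3 →L[ℝ] PBond P 0 → lieSU (Fin 2)} (hX : HasFDerivAt Xf X' 0)
    {X₂ : GaugeSlice S T E3 →L[ℝ] GaugeSlice S T E3 →L[ℝ] PBond P 0 → lieSU (Fin 2)} (hX₂ : HasFDerivAt (fun Y => fderiv ℝ Xf Y) X₂ 0)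
    (hXd : ∀ᶠ Y in 𝓝 (0 : GaugeSlice S T E3), DifferentiableAt ℝ Xf Y)
    (hval : ∀ᶠ Y in 𝓝 (0 : GaugeSlice S T E3), sliceFn S T f V Y = wilsonAction4 (expChart U₀ (Xf Y))) (X Y : GaugeSlice S T E3) :
    ⟪X, fderiv ℝ (rGrad S T (sliceFn S T f V)) 0 Y⟫_ℝ =
      fderiv ℝ (fun Y => fderiv ℝ (fun Y : GaugeSlice S T E3 => wilsonAction4 (expChart U₀ (Xf Y))) Y) 0 Y X :=
  inner_fderiv_rGrad S T (hasFDerivAt_fderiv_sliceFn_of_chartFamily S T f V U₀ hX hX₂ hXd hval) X Y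

end Pairing

/-! ## §3  Lower bounds transfer; the `h17` shape -/

section Shape

/-- ★★★ **ANY LOWER BOUND FOR THE VALUE HESSIAN ALONG THE FAMILY IS A LOWER BOUND FOR THE SLICE PAIRING** (diagonal, direction `X`).
[cite: Balaban1989LargeFieldII, (1.7) p.358, (1.12) p.359] -/
theorem le_inner_fderiv_rGrad_sliceFn_of_hessian_chartFamily_ge (f : GaugeField P k SU2 → ℝ) (V : GaugeField P k SU2) (U₀ : GaugeField P 0 SU2)
    {Xf : GaugeSlice S T E3 → PBond P 0 → lieSU (Fin 2)} {X' : GaugeSlice S T E3 →L[ℝ] PBond P 0 → lieSU (Fin 2)} (hX : HasFDerivAt Xf X' 0)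
    {X₂ : GaugeSlice S T E3 →L[ℝ] GaugeSlice S T E3 →L[ℝ] PBond P 0 → lieSU (Fin 2)} (hX₂ : HasFDerivAt (fun Y => fderiv ℝ Xf Y) X₂ 0)
    (hXd : ∀ᶠ Y in 𝓝 (0 : GaugeSlice S T E3), DifferentiableAt ℝ Xf Y)
    (hval : ∀ᶠ Y in 𝓝 (0 : GaugeSlice S T E3), sliceFn S T f V Y = wilsonAction4 (expChart U₀ (Xf Y))) (X : GaugeSlice S T E3) {lb : ℝ}
    (hlow : lb ≤ fderiv ℝ (fun Y => fderiv ℝ (fun Y : GaugeSlice S T E3 => wilsonAction4 (expChart U₀ (Xf Y))) Y) 0 X X) :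
    lb ≤ ⟪X, fderiv ℝ (rGrad S T (sliceFn S T f V)) 0 X⟫_ℝ := by
  rw [inner_fderiv_rGrad_sliceFn_eq_hessian_chartFamily S T f V U₀ hX hX₂ hXd hval X X]
  exact hlow

/-- One line of arithmetic behind the `h17` shape: `m − C·p² ≤ H`, `γ₀·c ≤ m`, `p ≤ K·n`, `0 ≤ p`, `0 ≤ C` ⇒ `γ₀·c − (C·K²)·n² ≤ H` (private plumbing). [folklore] -/
private theorem shape_arith {H m C p Kc nX γ₀ c : ℝ} (hlow : m - C * p ^ 2 ≤ H) (hm : γ₀ * c ≤ m) (hK : p ≤ Kc * nX) (hp : 0 ≤ p) (hC : 0 ≤ C) :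
    γ₀ * c - C * Kc ^ 2 * nX ^ 2 ≤ H := by
  have h1 : p ^ 2 ≤ (Kc * nX) ^ 2 := pow_le_pow_left₀ hp hK 2
  have h2 : C * p ^ 2 ≤ C * Kc ^ 2 * nX ^ 2 := by
    calc C * p ^ 2 ≤ C * (Kc * nX) ^ 2 := mul_le_mul_of_nonneg_left h1 hC
      _ = C * Kc ^ 2 * nX ^ 2 := by ring
  linarith

/-- ★★★ **THE `h17` SHAPE FROM A VALUE-HESSIAN BOUND ALONG THE FAMILY**: if `m − C·p(X_f′X)² ≤ D²(A∘expChart U₀∘X_f)(0)[X,X]` (the shape dag-n12-w4's skeleton concludes),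
`γ₀·circ ≤ m` (the Federbush fibre letter `hm` at this direction), `p(X_f′X) ≤ K_c‖X‖` (the family letter (K)) and `0 ≤ C`, then
`γ₀·circ − (C·K_c²)·‖X‖² ≤ ⟪X, D(∇ sliceFn S T f Ṽ_k)(0) X⟫` — the letter `h17` of the N12∕s1 endpoints at this `(Ṽ_k, X)` with `Cerr = C·K_c²`.
[cite: Balaban1989LargeFieldII, (1.7)–(1.9) p.358, (1.12) p.359, p.357] -/
theorem h17Shape_of_hessian_chartFamily_ge (f : GaugeField P k SU2 → ℝ) (V : GaugeField P k SU2) (U₀ : GaugeField P 0 SU2)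
    {Xf : GaugeSlice S T E3 → PBond P 0 → lieSU (Fin 2)} {X' : GaugeSlice S T E3 →L[ℝ] PBond P 0 → lieSU (Fin 2)} (hX : HasFDerivAt Xf X' 0)
    {X₂ : GaugeSlice S T E3 →L[ℝ] GaugeSlice S T E3 →L[ℝ] PBond P 0 → lieSU (Fin 2)} (hX₂ : HasFDerivAt (fun Y => fderiv ℝ Xf Y) X₂ 0)
    (hXd : ∀ᶠ Y in 𝓝 (0 : GaugeSlice S T E3), DifferentiableAt ℝ Xf Y)
    (hval : ∀ᶠ Y in 𝓝 (0 : GaugeSlice S T E3), sliceFn S T f V Y = wilsonAction4 (expChart U₀ (Xf Y))) (X : GaugeSlice S T E3)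
    (p : Seminorm ℝ (PBond P 0 → lieSU (Fin 2))) {m C Kc γ₀ circ : ℝ} (hC : 0 ≤ C)
    (hlow : m - C * p (X' X) ^ 2 ≤ fderiv ℝ (fun Y => fderiv ℝ (fun Y : GaugeSlice S T E3 => wilsonAction4 (expChart U₀ (Xf Y))) Y) 0 X X)
    (hm : γ₀ * circ ≤ m) (hK : p (X' X) ≤ Kc * ‖X‖) :
    γ₀ * circ - C * Kc ^ 2 * ‖X‖ ^ 2 ≤ ⟪X, fderiv ℝ (rGrad S T (sliceFn S T f V)) 0 X⟫_ℝ :=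
  shape_arith (le_inner_fderiv_rGrad_sliceFn_of_hessian_chartFamily_ge S T f V U₀ hX hX₂ hXd hval X hlow) hm hK (apply_nonneg p _) hC

end Shape

/-! ## §4  Composition with the near-flat one-sided skeleton at the Wilson action -/

section NearFlat

/-- ★★★ **THE LETTER `h17` OF THE N12∕s1 ENDPOINTS FROM THE NEAR-FLAT ONE-SIDED SKELETON ALONG A C² FAMILY OF MINIMISERS.**  dag-n12-w4's
`B16Ineq17NearFlatWilsonLetters.hessian_wilsonAction4_criticalExpChartFamily_ge_flatMin_sub` (p599997) VERBATIM at the parameter space `G := GaugeSlice S T E3` (print's `B′` in the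
gauge-fixed coordinates), base `g₀ := 0`, direction `h := X` — a bond-wise `δ`-near-flat `U₀`, a `C²` constraint chart `Ψ` with the Lagrange form `D(A∘expChart U₀)(0) = λ ∘ DΨ(0)`,
the family `X_f` through `0`, affine datum `haff`, a seminorm `p` dominating the ℓ²-of-operator-norms, flat linearised constraint `L♭` with right inverse `R♭` and the displayed
letters (μ)(δ₂)(ρ), the Federbush fibre letter `hm` for `m` — COMPOSED with §1–§3: the value identity (K′) `hval` (the slice function IS `A(expChart U₀ (X_f ·))` near `0`,
e.g. from `eventually_sliceFn_fun177std_bg…_eq_wilsonAction4`), the family letter (K) `p(X_f′X) ≤ K_c‖X‖`, `γ₀·circ ≤ m` and the signs `0 ≤ δ, μ, δ₂` give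
`γ₀·circ − (32(d−1)δ + μ + 16(d−1)ρδ₂(2+ρδ₂))·K_c²·‖X‖² ≤ ⟪X, (fderiv ℝ (rGrad S T (sliceFn S T f Ṽ_k)) 0) X⟫` — the `h17` clause at `(Ṽ_k, X)` with
`Cerr = (32(d−1)δ + μ + 16(d−1)ρδ₂(2+ρδ₂))·K_c²`, print's «|E_A| ≤ O(1)M⁶R_kε_k|B′|²» one-sided ([LF-II] p. 357).
[cite: Balaban1989LargeFieldII, p.357, (1.7)–(1.9) p.358, (1.12)–(1.13) p.359; Balaban1989LargeFieldI, (1.77) and Prop. 1 p.194; Balaban1985Variational, (47) p.285, (81) p.290, Prop. 9 (190) p.309] -/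
theorem h17Shape_sliceFn_of_nearFlatCriticalExpChartFamily
    {W : Type*} [NormedAddCommGroup W] [NormedSpace ℝ W]
    (f : GaugeField P k SU2 → ℝ) (V : GaugeField P k SU2)
    (U₀ : GaugeField P 0 SU2) {δ : ℝ} (hδ0 : 0 ≤ δ) (hU : ∀ b : PBond P 0, ‖((U₀ b : SU2) : Matrix (Fin 2) (Fin 2) ℂ) - 1‖ ≤ δ)
    {Ψ : (PBond P 0 → lieSU (Fin 2)) → W} {Xf : GaugeSlice S T E3 → PBond P 0 → lieSU (Fin 2)}
    (hX₀ : Xf 0 = 0) {X' : GaugeSlice S T E3 →L[ℝ] PBond P 0 → lieSU (Fin 2)} (hX : HasFDerivAt Xf X' 0)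
    {X₂ : GaugeSlice S T E3 →L[ℝ] GaugeSlice S T E3 →L[ℝ] PBond P 0 → lieSU (Fin 2)} (hX₂ : HasFDerivAt (fun Y => fderiv ℝ Xf Y) X₂ 0)
    (hXd : ∀ᶠ Y in 𝓝 (0 : GaugeSlice S T E3), DifferentiableAt ℝ Xf Y)
    {Ψ₂ : (PBond P 0 → lieSU (Fin 2)) →L[ℝ] (PBond P 0 → lieSU (Fin 2)) →L[ℝ] W} (hΨ₂ : HasFDerivAt (fun Y => fderiv ℝ Ψ Y) Ψ₂ 0)
    (hΨd : ∀ᶠ Y in 𝓝 (0 : PBond P 0 → lieSU (Fin 2)), DifferentiableAt ℝ Ψ Y)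
    {lam : W →L[ℝ] ℝ} (hlam : fderiv ℝ (fun Y : PBond P 0 → lieSU (Fin 2) => wilsonAction4 (expChart U₀ Y)) 0 = lam.comp (fderiv ℝ Ψ 0))
    (X : GaugeSlice S T E3)
    (haff : lam (fderiv ℝ (fun g => fderiv ℝ (fun g => Ψ (Xf g)) g) 0 X X) = 0)
    (p : Seminorm ℝ (PBond P 0 → lieSU (Fin 2))) (hp : ∀ Y : PBond P 0 → lieSU (Fin 2), ∑ b, ‖(Y b : Matrix (Fin 2) (Fin 2) ℂ)‖ ^ 2 ≤ p Y ^ 2)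
    (q : W → ℝ) (Lf : (PBond P 0 → lieSU (Fin 2)) →L[ℝ] W) {Rf : W → PBond P 0 → lieSU (Fin 2)} {μ ρ δ₂ : ℝ} (hρ0 : 0 ≤ ρ) (hμ0 : 0 ≤ μ) (hδ₂0 : 0 ≤ δ₂)
    (hRf : ∀ v, Lf (Rf v) = v) (hρ : ∀ v, p (Rf v) ≤ ρ * q v)
    (hδ₂ : q (fderiv ℝ Ψ 0 (X' X) - Lf (X' X)) ≤ δ₂ * p (X' X))
    (hμ : lam (Ψ₂ (X' X) (X' X)) ≤ μ * p (X' X) ^ 2)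
    {m : ℝ} (hm : ∀ w', Lf w' = fderiv ℝ Ψ 0 (X' X) →
      m ≤ fderiv ℝ (fun Y => fderiv ℝ (fun Y : PBond P 0 → lieSU (Fin 2) => wilsonAction4 (expChart (1 : GaugeField P 0 SU2) Y)) Y) 0 w' w')
    -- (K′) the value identity along the family, (K) the family's seminorm bound, and the Federbush fibre constant
    (hval : ∀ᶠ Y in 𝓝 (0 : GaugeSlice S T E3), sliceFn S T f V Y = wilsonAction4 (expChart U₀ (Xf Y)))
    {Kc γ₀ circ : ℝ} (hK : p (X' X) ≤ Kc * ‖X‖) (hcirc : γ₀ * circ ≤ m) :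
    γ₀ * circ - (32 * ((P.d : ℝ) - 1) * δ + μ + 16 * ((P.d : ℝ) - 1) * (ρ * δ₂) * (2 + ρ * δ₂)) * Kc ^ 2 * ‖X‖ ^ 2
      ≤ ⟪X, fderiv ℝ (rGrad S T (sliceFn S T f V)) 0 X⟫_ℝ := by
  have hd : 0 ≤ (P.d : ℝ) - 1 := by
    have h1 : (1 : ℝ) ≤ P.d := by exact_mod_cast P.hd
    linarith
  have hC : 0 ≤ 32 * ((P.d : ℝ) - 1) * δ + μ + 16 * ((P.d : ℝ) - 1) * (ρ * δ₂) * (2 + ρ * δ₂) := by positivity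
  have hlow := hessian_wilsonAction4_criticalExpChartFamily_ge_flatMin_sub (N := 2) U₀ hU (Ψ := Ψ) (X := Xf) (g₀ := (0 : GaugeSlice S T E3))
    hX₀ hX hX₂ hXd hΨ₂ hΨd hlam X haff p hp q Lf hρ0 hRf hρ hδ₂ hμ hm
  exact h17Shape_of_hessian_chartFamily_ge S T f V U₀ hX hX₂ hXd hval X p hC hlow hcirc hK

end NearFlat

/-! ## §5  (v1.1) The twist editions: the Federbush letter with a quadratic defect `γ₀·circ(X) − τ·‖X‖² ≤ m`

At a CURVED background the producers of the fibre letter `hm` go through the Ad-twist of the datum velocity (dag-n12-w4's located (R2): `Node00.fderiv_msChart_comp_apply_eq_ad`,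
`B16Ineq17NearFlatDatumFamily.fderiv_msChart_comp_apply_top_of_isMinimizer_family`) and the twist letter (T) `B16Ineq17SliceTwist.circ_twist_ge_sub` returns the curl form of the
UNtwisted slice vector only up to a quadratic defect: what is producible is `γ₀·circ(X) − τ·‖X‖² ≤ m`, not `γ₀·circ(X) ≤ m` (dag-n12-w4 g3 LOCATED SHAPE NOTE, 2026-08-28T06:49Z).
These editions carry `τ` into `Cerr` (one `linarith`). -/

section Twist

/-- The arithmetic behind the twist edition: `m − C·p² ≤ H`, `γ₀·c − τ·n² ≤ m`, `p ≤ K·n`, `0 ≤ p`, `0 ≤ C` ⇒ `γ₀·c − (C·K² + τ)·n² ≤ H` (private plumbing). [folklore] -/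
private theorem shape_arith_sub {H m C p Kc nX γ₀ c τ : ℝ} (hlow : m - C * p ^ 2 ≤ H) (hm : γ₀ * c - τ * nX ^ 2 ≤ m) (hK : p ≤ Kc * nX) (hp : 0 ≤ p)
    (hC : 0 ≤ C) : γ₀ * c - (C * Kc ^ 2 + τ) * nX ^ 2 ≤ H := by
  have h1 : p ^ 2 ≤ (Kc * nX) ^ 2 := pow_le_pow_left₀ hp hK 2
  have h2 : C * p ^ 2 ≤ C * Kc ^ 2 * nX ^ 2 := by
    calc C * p ^ 2 ≤ C * (Kc * nX) ^ 2 := mul_le_mul_of_nonneg_left h1 hC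
      _ = C * Kc ^ 2 * nX ^ 2 := by ring
  nlinarith

/-- ★★★ **THE `h17` SHAPE FROM A VALUE-HESSIAN BOUND — TWIST EDITION**: as `h17Shape_of_hessian_chartFamily_ge`, with the Federbush letter carrying a quadratic defect
`γ₀·circ − τ·‖X‖² ≤ m` (the shape the twisted producers deliver); conclusion `γ₀·circ − (C·K_c² + τ)·‖X‖² ≤ ⟪X, D(∇ sliceFn S T f Ṽ_k)(0) X⟫`.
[cite: Balaban1989LargeFieldII, p.357, (1.7)–(1.9) p.358, (1.12) p.359, (1.19) p.360] -/
theorem h17Shape_of_hessian_chartFamily_ge_sub (f : GaugeField P k SU2 → ℝ) (V : GaugeField P k SU2) (U₀ : GaugeField P 0 SU2)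
    {Xf : GaugeSlice S T E3 → PBond P 0 → lieSU (Fin 2)} {X' : GaugeSlice S T E3 →L[ℝ] PBond P 0 → lieSU (Fin 2)} (hX : HasFDerivAt Xf X' 0)
    {X₂ : GaugeSlice S T E3 →L[ℝ] GaugeSlice S T E3 →L[ℝ] PBond P 0 → lieSU (Fin 2)} (hX₂ : HasFDerivAt (fun Y => fderiv ℝ Xf Y) X₂ 0)
    (hXd : ∀ᶠ Y in 𝓝 (0 : GaugeSlice S T E3), DifferentiableAt ℝ Xf Y)
    (hval : ∀ᶠ Y in 𝓝 (0 : GaugeSlice S T E3), sliceFn S T f V Y = wilsonAction4 (expChart U₀ (Xf Y))) (X : GaugeSlice S T E3)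
    (p : Seminorm ℝ (PBond P 0 → lieSU (Fin 2))) {m C Kc γ₀ circ τ : ℝ} (hC : 0 ≤ C)
    (hlow : m - C * p (X' X) ^ 2 ≤ fderiv ℝ (fun Y => fderiv ℝ (fun Y : GaugeSlice S T E3 => wilsonAction4 (expChart U₀ (Xf Y))) Y) 0 X X)
    (hm : γ₀ * circ - τ * ‖X‖ ^ 2 ≤ m) (hK : p (X' X) ≤ Kc * ‖X‖) :
    γ₀ * circ - (C * Kc ^ 2 + τ) * ‖X‖ ^ 2 ≤ ⟪X, fderiv ℝ (rGrad S T (sliceFn S T f V)) 0 X⟫_ℝ :=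
  shape_arith_sub (le_inner_fderiv_rGrad_sliceFn_of_hessian_chartFamily_ge S T f V U₀ hX hX₂ hXd hval X hlow) hm hK (apply_nonneg p _) hC

/-- ★★★ **THE LETTER `h17` FROM THE NEAR-FLAT SKELETON ALONG A C² FAMILY OF MINIMISERS — TWIST EDITION**: `h17Shape_sliceFn_of_nearFlatCriticalExpChartFamily` with the Federbush
letter in the twisted shape `γ₀·circ − τ·‖X‖² ≤ m` (`0 ≤ τ` not needed); conclusion `γ₀·circ − ((32(d−1)δ + μ + 16(d−1)ρδ₂(2+ρδ₂))·K_c² + τ)·‖X‖² ≤ ⟪X, (fderiv ℝ (rGrad S T (sliceFn S T f Ṽ_k)) 0) X⟫`.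
[cite: Balaban1989LargeFieldII, p.357, (1.7)–(1.9) p.358, (1.12)–(1.13) p.359, (1.19) p.360; Balaban1989LargeFieldI, (1.77) and Prop. 1 p.194; Balaban1985Variational, (47) p.285, (81) p.290] -/
theorem h17Shape_sliceFn_of_nearFlatCriticalExpChartFamily_sub
    {W : Type*} [NormedAddCommGroup W] [NormedSpace ℝ W]
    (f : GaugeField P k SU2 → ℝ) (V : GaugeField P k SU2)
    (U₀ : GaugeField P 0 SU2) {δ : ℝ} (hδ0 : 0 ≤ δ) (hU : ∀ b : PBond P 0, ‖((U₀ b : SU2) : Matrix (Fin 2) (Fin 2) ℂ) - 1‖ ≤ δ)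
    {Ψ : (PBond P 0 → lieSU (Fin 2)) → W} {Xf : GaugeSlice S T E3 → PBond P 0 → lieSU (Fin 2)}
    (hX₀ : Xf 0 = 0) {X' : GaugeSlice S T E3 →L[ℝ] PBond P 0 → lieSU (Fin 2)} (hX : HasFDerivAt Xf X' 0)
    {X₂ : GaugeSlice S T E3 →L[ℝ] GaugeSlice S T E3 →L[ℝ] PBond P 0 → lieSU (Fin 2)} (hX₂ : HasFDerivAt (fun Y => fderiv ℝ Xf Y) X₂ 0)
    (hXd : ∀ᶠ Y in 𝓝 (0 : GaugeSlice S T E3), DifferentiableAt ℝ Xf Y)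
    {Ψ₂ : (PBond P 0 → lieSU (Fin 2)) →L[ℝ] (PBond P 0 → lieSU (Fin 2)) →L[ℝ] W} (hΨ₂ : HasFDerivAt (fun Y => fderiv ℝ Ψ Y) Ψ₂ 0)
    (hΨd : ∀ᶠ Y in 𝓝 (0 : PBond P 0 → lieSU (Fin 2)), DifferentiableAt ℝ Ψ Y)
    {lam : W →L[ℝ] ℝ} (hlam : fderiv ℝ (fun Y : PBond P 0 → lieSU (Fin 2) => wilsonAction4 (expChart U₀ Y)) 0 = lam.comp (fderiv ℝ Ψ 0))
    (X : GaugeSlice S T E3)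
    (haff : lam (fderiv ℝ (fun g => fderiv ℝ (fun g => Ψ (Xf g)) g) 0 X X) = 0)
    (p : Seminorm ℝ (PBond P 0 → lieSU (Fin 2))) (hp : ∀ Y : PBond P 0 → lieSU (Fin 2), ∑ b, ‖(Y b : Matrix (Fin 2) (Fin 2) ℂ)‖ ^ 2 ≤ p Y ^ 2)
    (q : W → ℝ) (Lf : (PBond P 0 → lieSU (Fin 2)) →L[ℝ] W) {Rf : W → PBond P 0 → lieSU (Fin 2)} {μ ρ δ₂ : ℝ} (hρ0 : 0 ≤ ρ) (hμ0 : 0 ≤ μ) (hδ₂0 : 0 ≤ δ₂)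
    (hRf : ∀ v, Lf (Rf v) = v) (hρ : ∀ v, p (Rf v) ≤ ρ * q v)
    (hδ₂ : q (fderiv ℝ Ψ 0 (X' X) - Lf (X' X)) ≤ δ₂ * p (X' X))
    (hμ : lam (Ψ₂ (X' X) (X' X)) ≤ μ * p (X' X) ^ 2)
    {m : ℝ} (hm : ∀ w', Lf w' = fderiv ℝ Ψ 0 (X' X) →
      m ≤ fderiv ℝ (fun Y => fderiv ℝ (fun Y : PBond P 0 → lieSU (Fin 2) => wilsonAction4 (expChart (1 : GaugeField P 0 SU2) Y)) Y) 0 w' w')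
    (hval : ∀ᶠ Y in 𝓝 (0 : GaugeSlice S T E3), sliceFn S T f V Y = wilsonAction4 (expChart U₀ (Xf Y)))
    {Kc γ₀ circ τ : ℝ} (hK : p (X' X) ≤ Kc * ‖X‖) (hcirc : γ₀ * circ - τ * ‖X‖ ^ 2 ≤ m) :
    γ₀ * circ - ((32 * ((P.d : ℝ) - 1) * δ + μ + 16 * ((P.d : ℝ) - 1) * (ρ * δ₂) * (2 + ρ * δ₂)) * Kc ^ 2 + τ) * ‖X‖ ^ 2
      ≤ ⟪X, fderiv ℝ (rGrad S T (sliceFn S T f V)) 0 X⟫_ℝ := by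
  have hd : 0 ≤ (P.d : ℝ) - 1 := by
    have h1 : (1 : ℝ) ≤ P.d := by exact_mod_cast P.hd
    linarith
  have hC : 0 ≤ 32 * ((P.d : ℝ) - 1) * δ + μ + 16 * ((P.d : ℝ) - 1) * (ρ * δ₂) * (2 + ρ * δ₂) := by positivity
  have hlow := hessian_wilsonAction4_criticalExpChartFamily_ge_flatMin_sub (N := 2) U₀ hU (Ψ := Ψ) (X := Xf) (g₀ := (0 : GaugeSlice S T E3))
    hX₀ hX hX₂ hXd hΨ₂ hΨd hlam X haff p hp q Lf hρ0 hRf hρ hδ₂ hμ hm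
  exact h17Shape_of_hessian_chartFamily_ge_sub S T f V U₀ hX hX₂ hXd hval X p hC hlow hcirc hK

end Twist

end Literature.MathematicalPhysics.QuantumFieldTheory.Balaban1983to89.B15Prop1SliceHessianOfChartFamily

end
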